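import Summits.AtomisticToContinuum.FouriersLaw.Theorems.LatticeLandauDampingAbelThermodynamicLimitWindowRegularity
import HarnessLib

/-!
# Split kit r1 — crux `LatticeLandauDamping.AbelThermodynamicLimit` (stmt-AtomisticToContinuum-14013) as an honest AND-node

Strategist `planner-cstrat-stmt-AtomisticToContinuum-14013-r1-0` (REDIRECT r1).  The crux is decomposed into TWO pieces,
neither of which is the crux or the summit reworded:

* `UniformAbelianRegularity` — VERBATIM the signature of stmt-AtomisticToContinuum-13416
  (`StaticAbelianSqueeze.UniformAbelianRegularity`, (R)); the `Iff.rfl` below certifies the dedup;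
* `AbelGreenKuboSI` — the HONEST shift-invariant Abelian Green–Kubo witness (DLR Gibbs state that IS lattice-shift invariant,
  measure-preserving infinite-volume dynamics, absolutely convergent current correlations, `κ > 0`, Abel limit `κ`): VERBATIM the
  conclusion of the landed `WindowRegularity.stub_abelGreenKuboSIOfWindow` (p166022), i.e. exactly what this route's deciding
  theorem `closes` builds from its three spectral cruxes `WindowDecomposition` / `NoDrudeWeight` / `PositiveDensity`
  (stmt-14011 / 14012 / 14014) and the PROVED `AbelOfSpectralDensity` (stmt-12598).

Assembly `AbelThermodynamicLimit_of_subs : UniformAbelianRegularity → AbelGreenKuboSI → AbelThermodynamicLimit` is PROVED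
(sorry-free) from the landed `SeriesLawAtEveryLaplaceFrequency.abelThermodynamicLimit_of_uniformAbelianRegularity` (p127738) and
`WindowRegularity.witnessShiftInvariant_of_abelGreenKuboSI` (p166022).  `abelGreenKuboSI_of_window` records the in-route plan for
piece 2.  Probes (`bc/*.lean` of the strategist folder, results in `STRATEGY-CENSUS-14013r1.md` §Probes): no piece gives the summit `FouriersLaw` or the crux on
its own.  The assembly is ALSO landed importably as `Theorems/LatticeLandauDampingAbelThermodynamicLimitSplit.lean` (p172329).
-/

namespace Summit.AtomisticToContinuum.FouriersLaw.Theses.LatticeLandauDamping.SplitR1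

/-- Piece 1 (crux, = stmt-AtomisticToContinuum-13416 VERBATIM): (R) uniform Abelian regularity of the open chain's equilibrium
total-current autocorrelation. -/
def UniformAbelianRegularity : Prop :=
  ∀ ω₂ lam β γ : ℝ, 0 < ω₂ → 0 < lam → 0 < β → 0 < γ → ∀ T : ℝ, 0 < T → ∀ ε : ℝ, 0 < ε → ∃ ν₀ : ℝ, 0 < ν₀ ∧ ∀ ν : ℝ, 0 < ν → ν < ν₀ → ∃ N₀ : ℕ, ∀ N : ℕ, N₀ ≤ N → let J : Literature.MathematicalPhysics.KineticTheory.HeatConduction.PhaseSpace N → ℝ := fun z => ∑ i : Fin N, (Literature.MathematicalPhysics.KineticTheory.HeatConduction.pinnedChain ω₂ lam β γ).bondCurrent N i z; |∫ t in Set.Ioi (0:ℝ), (1 - Real.exp (-(ν * t))) * ∫ z, J z * (∫ y, J y ∂((Literature.MathematicalPhysics.KineticTheory.HeatConduction.pinnedChain ω₂ lam β γ).transitionKernel N T T t.toNNReal z)) ∂((Literature.MathematicalPhysics.KineticTheory.HeatConduction.pinnedChain ω₂ lam β γ).gibbsMeasure N T)| ≤ ε * N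

/-- Dedup certificate: piece 1 IS stmt-13416's declaration, definitionally. -/
example : UniformAbelianRegularity ↔ Summit.AtomisticToContinuum.FouriersLaw.Theses.StaticAbelianSqueeze.UniformAbelianRegularity :=
  Iff.rfl

/-- Piece 2 (support; discharged in-route by WD ∧ NDW ∧ PD, `abelGreenKuboSI_of_window` below): the honest SHIFT-INVARIANT Abelian
Green–Kubo witness at every temperature. -/
def AbelGreenKuboSI : Prop :=
    ∀ ω₂ lam β γ : ℝ, 0 < ω₂ → 0 < lam → 0 < β → 0 < γ → ∀ T : ℝ, 0 < T →
      ∃ (μT : MeasureTheory.Measure Literature.MathematicalPhysics.KineticTheory.HeatConduction.ChainConfig)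
        (D : Literature.MathematicalPhysics.KineticTheory.HeatConduction.InfiniteChainDynamics
          (Literature.MathematicalPhysics.KineticTheory.HeatConduction.pinnedChain ω₂ lam β γ)) (κ : ℝ),
        (Literature.MathematicalPhysics.KineticTheory.HeatConduction.pinnedChain ω₂ lam β γ).IsChainGibbsMeasure T μT ∧
        Literature.MathematicalPhysics.KineticTheory.HeatConduction.IsShiftInvariant μT ∧
        D.PreservesMeasure μT ∧
        (∀ t : ℝ, D.HasAbsConvergentCorrelation μT t) ∧ 0 < κ ∧
        Filter.Tendsto (fun ν : ℝ => (T ^ 2)⁻¹ *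
          MeasureTheory.integral (MeasureTheory.volume.restrict (Set.Ioi (0:ℝ)))
            (fun t : ℝ => Real.exp (-(ν * t)) * (D.currentCorrelation μT) t))
          (nhdsWithin (0:ℝ) (Set.Ioi 0)) (nhds κ)

/-- The in-route plan for piece 2: the route's three spectral cruxes give it (landed p166022, verbatim). -/
theorem abelGreenKuboSI_of_window :
    WindowDecomposition → NoDrudeWeight → PositiveDensity → AbelGreenKuboSI :=
  Summit.AtomisticToContinuum.FouriersLaw.Theorems.AbelThermodynamicLimit.WindowRegularity.stub_abelGreenKuboSIOfWindow

/-- Piece 2 also gives the route's filed target `AbelGreenKubo` (stmt-14010). -/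
theorem abelGreenKubo_of_abelGreenKuboSI' : AbelGreenKuboSI → AbelGreenKubo :=
  Summit.AtomisticToContinuum.FouriersLaw.Theorems.AbelThermodynamicLimit.WindowRegularity.abelGreenKubo_of_abelGreenKuboSI

/-- **Assembly (PROVED)**: the two pieces give the crux BY NAME. -/
theorem AbelThermodynamicLimit_of_subs :
    UniformAbelianRegularity → AbelGreenKuboSI → AbelThermodynamicLimit :=
  fun hR hX =>
    Summit.AtomisticToContinuum.FouriersLaw.Theorems.AbelThermodynamicLimit.SeriesLawAtEveryLaplaceFrequency.abelThermodynamicLimit_of_uniformAbelianRegularity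
      hR
      (Summit.AtomisticToContinuum.FouriersLaw.Theorems.AbelThermodynamicLimit.WindowRegularity.witnessShiftInvariant_of_abelGreenKuboSI
        hX)

/-- Route-level record: the two pieces plus the route's three spectral cruxes give the CONJUNCT through the route's own `closes`
(so the split changes nothing about what the route must prove: {13416, 14011, 14012, 14014}). -/
theorem fouriersLaw_of_subs_of_window (hR : UniformAbelianRegularity)
    (hW : WindowDecomposition) (hND : NoDrudeWeight) (hPD : PositiveDensity) : _root_.FouriersLaw :=
  closes hW hND hPD
    Summit.AtomisticToContinuum.FouriersLaw.Theorems.AbelOfSpectralDensity.latticeLandauDamping_abelOfSpectralDensity_proof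
    (AbelThermodynamicLimit_of_subs hR (abelGreenKuboSI_of_window hW hND hPD)) NessUnique_holds FiniteResponseOfUnique_holds

end Summit.AtomisticToContinuum.FouriersLaw.Theses.LatticeLandauDamping.SplitR1
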